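import Summits.Ventures.PercRepro.OneEdgeMonoDel

/-!
# PercRepro — the `a–b` edge is an exact tie of the C-026 class slack (p1, gen 5)

The `a–b` case of `OneEdgeMonoC026` (mine-3 2182 (a): «the ab-edge is an exact tie»), in the kernel: for an
edge `e` joining the marks `a` and `b`, `CS(G − e) = CS(G)` on every marked multigraph.  By the class
deletion–contraction identity (`OneEdgeMonoDel.lean`) this is `CS(G/e) = #C₂(G, e)`, and both sides vanish:
opening an `a–b` edge never changes whether `c` is isolated from `{a, b}` (so `e` is never pivotal for
`c ~ {a, b}` and `C₂ = ∅`), and with `e` open in both copies the kernel is `[a ≁_ρ c] − [a ≁_{τ(ρ)} c]`,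
antisymmetric under the antipodal involution `τ` of the `e`-open half.  Parked beside `OneEdgeMono.lean`
(not in the landing set unless asked).

* **`IsABEdge`**, **`conn_ab_of_isABEdge`**, **`isCIso_update_true_iff_of_isABEdge`**;
* **`not_crosswise_of_isABEdge`** — `C₂(G, e) = ∅`; **`cubeSumCon_eq_zero_of_isABEdge`** — `CS(G/e) = 0`;
* **`cubeSumQuad_deleteEdge_eq_of_isABEdge`** — the tie `CS(G − e) = CS(G)`;
* **`deleteEdge_le_iff_of_isCAEdge`** — at a `c–a` edge (`IsABEdge c a e`) the hypothesis is the counting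
  inequality `#{S ⊆ E(G − e) : a ≁ b, b ~ c, c iso in S̄} ≤ #{S ⊆ E(G − e) : a ≁ b, b ≁ c}` (the class twin of
  p5's «free step» at mark–mark edges; census-true, not a tie — the prover's explicit target there).
-/

namespace PercRepro

open Finset

section ABEdge

variable {E : Type*} [Fintype E] [DecidableEq E]

namespace MultiGraph

variable {V : Type*} (G : MultiGraph V E)

/-- The edge `e` joins the marks `a` and `b`. -/
def IsABEdge (a b : V) (e : E) : Prop :=
  (G.fst e = a ∧ G.snd e = b) ∨ (G.fst e = b ∧ G.snd e = a)

omit [Fintype E] [DecidableEq E] in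
/-- With an `a–b` edge open, `a ~ b`. -/
theorem conn_ab_of_isABEdge {a b : V} {e : E} (he : G.IsABEdge a b e) {ω : Config E}
    (hω : ω e = true) : G.Conn ω a b := by
  have h := Conn.of_openAdj (G.openAdj_of_open e hω)
  rcases he with ⟨h1, h2⟩ | ⟨h1, h2⟩
  · rw [h1, h2] at h
    exact h
  · rw [h1, h2] at h
    exact h.symm

omit [Fintype E] in
/-- **Opening an `a–b` edge never changes whether `c` is isolated from `{a, b}`.** -/
theorem isCIso_update_true_iff_of_isABEdge {a b c : V} {e : E} (he : G.IsABEdge a b e)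
    (ω : Config E) : G.IsCIso (Function.update ω e true) a b c ↔ G.IsCIso ω a b c := by
  unfold IsCIso
  rw [G.conn_update_true_iff, G.conn_update_true_iff]
  rcases he with ⟨h1, h2⟩ | ⟨h1, h2⟩
  · rw [h1, h2]
    constructor
    · rintro ⟨hac, hbc⟩
      exact ⟨fun h => hac (Or.inl h), fun h => hbc (Or.inl h)⟩
    · rintro ⟨hac, hbc⟩
      refine ⟨?_, ?_⟩
      · rintro (h | ⟨-, h⟩ | ⟨-, h⟩)
        · exact hac h
        · exact hbc h
        · exact hac h
      · rintro (h | ⟨-, h⟩ | ⟨-, h⟩)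
        · exact hbc h
        · exact hbc h
        · exact hac h
  · rw [h1, h2]
    constructor
    · rintro ⟨hac, hbc⟩
      exact ⟨fun h => hac (Or.inl h), fun h => hbc (Or.inl h)⟩
    · rintro ⟨hac, hbc⟩
      refine ⟨?_, ?_⟩
      · rintro (h | ⟨-, h⟩ | ⟨-, h⟩)
        · exact hac h
        · exact hac h
        · exact hbc h
      · rintro (h | ⟨-, h⟩ | ⟨-, h⟩)
        · exact hbc h
        · exact hac h
        · exact hbc h

omit [Fintype E] in
/-- At an `a–b` edge the crosswise set is empty: `e` is never pivotal for `c ~ {a, b}`. -/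
theorem not_crosswise_of_isABEdge {a b c : V} {e : E} (he : G.IsABEdge a b e) (ρ : Config E) :
    ¬ G.Crosswise a b c e ρ := by
  rintro ⟨hρ, -, -, h4, h3⟩
  have key := (G.isCIso_update_true_iff_of_isABEdge he (Function.update ρᶜ e false)).2 h4
  rw [Function.update_idem, update_eq_self_of_eq (compl_apply_of_eq_false hρ)] at key
  exact h3 key

omit [Fintype E] [DecidableEq E] in
open Classical in
/-- With an `a–b` edge open in both copies the kernel is `[a ≁_ρ c] − [a ≁_τ c]`. -/
theorem kernel26_eq_of_isABEdge {a b c : V} {e : E} (he : G.IsABEdge a b e) {ρ τ : Config E}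
    (hρ : ρ e = true) (hτ : τ e = true) :
    kernel26 (G.markedPartition ρ ![a, b, c]) (G.markedPartition τ ![a, b, c]) =
      (if ¬ G.Conn ρ a c then 1 else 0) - (if ¬ G.Conn τ a c then 1 else 0) := by
  rw [G.kernel26_eq_ite']
  have hab := G.conn_ab_of_isABEdge he hρ
  have hab' := G.conn_ab_of_isABEdge he hτ
  have h1 : G.OnePair ρ a b c ↔ ¬ G.Conn ρ a c := by
    constructor
    · rintro (⟨-, h⟩ | ⟨-, h⟩ | ⟨-, h⟩)
      · exact h
      · exact absurd hab h
      · exact absurd hab h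
    · intro h
      exact Or.inl ⟨hab, h⟩
  have h2 : G.Conn ρ a b ∧ G.IsCIso τ a b c ↔ ¬ G.Conn τ a c := by
    constructor
    · rintro ⟨-, h, -⟩
      exact h
    · intro h
      exact ⟨hab, h, fun h' => h (hab'.trans h')⟩
  rw [if_congr h1 rfl rfl, if_congr h2 rfl rfl]

omit [Fintype E] in
/-- The antipode with `e` re-opened is an involution of the `e`-open half of the cube. -/
theorem update_compl_update_compl {ρ : Config E} {e : E} (hρ : ρ e = true) :
    Function.update (Function.update ρᶜ e true)ᶜ e true = ρ := by
  rw [compl_update, compl_compl, Bool.not_true, Function.update_idem, update_eq_self_of_eq hρ]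

open Classical in
/-- **At an `a–b` edge the contraction sum vanishes**: the summand `[a ≁_ρ c] − [a ≁_{τ(ρ)} c]` is
antisymmetric under the involution `τ` of the `e`-open half. -/
theorem cubeSumCon_eq_zero_of_isABEdge {a b c : V} {e : E} (he : G.IsABEdge a b e) :
    cubeSumCon kernel26 (fun ρ => G.markedPartition ρ ![a, b, c]) e = 0 := by
  unfold cubeSumCon
  rw [← Finset.sum_filter]
  have hsum : ∑ ρ ∈ Finset.univ.filter (fun ρ : Config E => ρ e = true),
      kernel26 (G.markedPartition ρ ![a, b, c])
        (G.markedPartition (Function.update ρᶜ e true) ![a, b, c]) =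
      ∑ ρ ∈ Finset.univ.filter (fun ρ : Config E => ρ e = true),
        ((if ¬ G.Conn ρ a c then (1 : ℝ) else 0) -
          (if ¬ G.Conn (Function.update ρᶜ e true) a c then 1 else 0)) := by
    refine Finset.sum_congr rfl fun ρ hρ => ?_
    exact G.kernel26_eq_of_isABEdge he (Finset.mem_filter.1 hρ).2 (Function.update_self ..)
  rw [hsum, Finset.sum_sub_distrib, sub_eq_zero]
  refine Finset.sum_nbij' (fun ρ => Function.update ρᶜ e true) (fun ρ => Function.update ρᶜ e true)
    (fun ρ _ => Finset.mem_filter.2 ⟨Finset.mem_univ _, Function.update_self ..⟩)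
    (fun ρ _ => Finset.mem_filter.2 ⟨Finset.mem_univ _, Function.update_self ..⟩)
    (fun ρ hρ => update_compl_update_compl (Finset.mem_filter.1 hρ).2)
    (fun ρ hρ => update_compl_update_compl (Finset.mem_filter.1 hρ).2) ?_
  intro ρ hρ
  rw [update_compl_update_compl (Finset.mem_filter.1 hρ).2]

open Classical in
/-- **The `a–b` edge is an exact tie** (mine-3 2182 (a)): `CS(G − e) = CS(G)` — the `a–b` case of
`OneEdgeMonoC026` holds with equality, on every marked multigraph. -/
theorem cubeSumQuad_deleteEdge_eq_of_isABEdge {a b c : V} {e : E} (he : G.IsABEdge a b e) :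
    (G.deleteEdge e).cubeSumQuad ![a, b, c] kernel26 = G.cubeSumQuad ![a, b, c] kernel26 := by
  rw [G.cubeSumQuad_deleteEdge, G.cubeSumQuad_kernel26_eq_del_add_con a b c e,
    G.cubeSumCon_eq_zero_of_isABEdge he,
    Finset.filter_eq_empty_iff.2 fun ρ _ => G.not_crosswise_of_isABEdge he ρ]
  simp

/-! ### The `c–a` edge: the reduced target

At an edge joining `c` and a mark `a` the hypothesis is NOT a tie (mine-3 2182 (a): census-true, the class twin
of p5's «free step»); by the deletion–contraction identity it is the one-copy / two-copy counting inequality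
on `H = G − e`:  `#{S : a ≁ b, b ~ c, c iso in S̄} ≤ #{S : a ≁ b, b ≁ c}`  (`deleteEdge_le_iff_of_isCAEdge`). -/

omit [Fintype E] in
/-- Opening a `c–a` edge joins `a` to `b` iff `a ~ b` or `c ~ b` already. -/
theorem conn_update_true_iff_of_isCAEdge {a b c : V} {e : E} (he : G.IsABEdge c a e)
    (ρ : Config E) : G.Conn (Function.update ρ e true) a b ↔ G.Conn ρ a b ∨ G.Conn ρ c b := by
  rw [G.conn_update_true_iff]
  rcases he with ⟨h1, h2⟩ | ⟨h1, h2⟩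
  · rw [h1, h2]
    constructor
    · rintro (h | ⟨-, h⟩ | ⟨-, h⟩)
      · exact Or.inl h
      · exact Or.inl h
      · exact Or.inr h
    · rintro (h | h)
      · exact Or.inl h
      · exact Or.inr (Or.inr ⟨Conn.refl G ρ a, h⟩)
  · rw [h1, h2]
    constructor
    · rintro (h | ⟨-, h⟩ | ⟨-, h⟩)
      · exact Or.inl h
      · exact Or.inr h
      · exact Or.inl h
    · rintro (h | h)
      · exact Or.inl h
      · exact Or.inr (Or.inl ⟨Conn.refl G ρ a, h⟩)

omit [Fintype E] [DecidableEq E] in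
/-- With a `c–a` edge open, `c` is not isolated. -/
theorem not_isCIso_of_isCAEdge {a b c : V} {e : E} (he : G.IsABEdge c a e) {ω : Config E}
    (hω : ω e = true) : ¬ G.IsCIso ω a b c :=
  fun h => h.1 (G.conn_ab_of_isABEdge he hω).symm

omit [Fintype E] in
/-- The crosswise set at a `c–a` edge: `e` closed, `a ≁ b`, `c ~ b`, and `c` isolated in the antipode inside
`G − e` (the last conjunct of `Crosswise` is automatic). -/
theorem crosswise_iff_of_isCAEdge {a b c : V} {e : E} (he : G.IsABEdge c a e) (ρ : Config E) :
    G.Crosswise a b c e ρ ↔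
      ρ e = false ∧ ¬ G.Conn ρ a b ∧ G.Conn ρ c b ∧ G.IsCIso (Function.update ρᶜ e false) a b c := by
  unfold Crosswise
  constructor
  · rintro ⟨hρ, h1, h2, h3, -⟩
    refine ⟨hρ, h1, ?_, h3⟩
    rcases (G.conn_update_true_iff_of_isCAEdge he ρ).1 h2 with h | h
    · exact absurd h h1
    · exact h
  · rintro ⟨hρ, h1, h2, h3⟩
    exact ⟨hρ, h1, (G.conn_update_true_iff_of_isCAEdge he ρ).2 (Or.inr h2), h3,
      G.not_isCIso_of_isCAEdge he (compl_apply_of_eq_false hρ)⟩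

omit [Fintype E] [DecidableEq E] in
open Classical in
/-- With a `c–a` edge open in both copies the kernel is `[a ≁_ρ b]`. -/
theorem kernel26_eq_of_isCAEdge {a b c : V} {e : E} (he : G.IsABEdge c a e) {ρ τ : Config E}
    (hρ : ρ e = true) (hτ : τ e = true) :
    kernel26 (G.markedPartition ρ ![a, b, c]) (G.markedPartition τ ![a, b, c]) =
      if ¬ G.Conn ρ a b then 1 else 0 := by
  rw [G.kernel26_eq_ite']
  have hac : G.Conn ρ a c := (G.conn_ab_of_isABEdge he hρ).symm
  have h1 : G.OnePair ρ a b c ↔ ¬ G.Conn ρ a b := by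
    constructor
    · rintro (⟨-, h⟩ | ⟨-, h⟩ | ⟨-, h⟩)
      · exact absurd hac h
      · exact h
      · exact h
    · intro h
      exact Or.inr (Or.inl ⟨hac, h⟩)
  have h2 : ¬ (G.Conn ρ a b ∧ G.IsCIso τ a b c) := fun h => G.not_isCIso_of_isCAEdge he hτ h.2
  rw [if_congr h1 rfl rfl, if_neg h2, sub_zero]

open Classical in
/-- **At a `c–a` edge the contraction sum counts `{e open, a ≁ b}`.** -/
theorem cubeSumCon_eq_of_isCAEdge {a b c : V} {e : E} (he : G.IsABEdge c a e) :
    cubeSumCon kernel26 (fun ρ => G.markedPartition ρ ![a, b, c]) e =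
      ((Finset.univ.filter fun ρ : Config E => ρ e = true ∧ ¬ G.Conn ρ a b).card : ℝ) := by
  unfold cubeSumCon
  rw [Finset.card_filter, Nat.cast_sum]
  refine Finset.sum_congr rfl fun ρ _ => ?_
  by_cases hρ : ρ e = true
  · rw [if_pos hρ, G.kernel26_eq_of_isCAEdge he hρ (Function.update_self ..)]
    simp [hρ]
  · simp [hρ]

open Classical in
/-- **The `c–a` edge in one copy**: `#{e open, a ≁ b} = #{e closed, a ≁ b, b ≁ c}` (flip `e`). -/
theorem card_open_not_conn_eq_of_isCAEdge {a b c : V} {e : E} (he : G.IsABEdge c a e) :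
    (Finset.univ.filter fun ρ : Config E => ρ e = true ∧ ¬ G.Conn ρ a b).card =
      (Finset.univ.filter fun ρ : Config E =>
        ρ e = false ∧ ¬ G.Conn ρ a b ∧ ¬ G.Conn ρ c b).card := by
  refine Finset.card_bij' (fun ρ _ => Function.update ρ e false) (fun ρ _ => Function.update ρ e true)
    ?_ ?_ ?_ ?_
  · intro ρ hρ
    obtain ⟨-, h1, h2⟩ := Finset.mem_filter.1 hρ
    have hρ' : Function.update (Function.update ρ e false) e true = ρ := by
      rw [Function.update_idem, update_eq_self_of_eq h1]
    rw [← hρ', G.conn_update_true_iff_of_isCAEdge he] at h2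
    exact Finset.mem_filter.2 ⟨Finset.mem_univ _,
      Function.update_self .., fun h => h2 (Or.inl h), fun h => h2 (Or.inr h)⟩
  · intro ρ hρ
    obtain ⟨-, -, h2, h3⟩ := Finset.mem_filter.1 hρ
    refine Finset.mem_filter.2 ⟨Finset.mem_univ _, Function.update_self .., ?_⟩
    rw [G.conn_update_true_iff_of_isCAEdge he]
    rintro (h | h)
    · exact h2 h
    · exact h3 h
  · intro ρ hρ
    exact (Function.update_idem ..).trans (update_eq_self_of_eq (Finset.mem_filter.1 hρ).2.1)
  · intro ρ hρ
    exact (Function.update_idem ..).trans (update_eq_self_of_eq (Finset.mem_filter.1 hρ).2.1)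

open Classical in
/-- **The reduced target at a `c–a` edge** (the class twin of p5's «free step»): `CS(G − e) ≤ CS(G)` iff
`#{S ⊆ E(G − e) : a ≁ b, b ~ c, c iso in S̄} ≤ #{S ⊆ E(G − e) : a ≁ b, b ≁ c}` — both counts read in `G` with
`e` closed, `S̄` the antipode inside `G − e`. -/
theorem deleteEdge_le_iff_of_isCAEdge {a b c : V} {e : E} (he : G.IsABEdge c a e) :
    (G.deleteEdge e).cubeSumQuad ![a, b, c] kernel26 ≤ G.cubeSumQuad ![a, b, c] kernel26 ↔
      (Finset.univ.filter fun ρ : Config E => ρ e = false ∧ ¬ G.Conn ρ a b ∧ G.Conn ρ c b ∧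
          G.IsCIso (Function.update ρᶜ e false) a b c).card ≤
        (Finset.univ.filter fun ρ : Config E =>
          ρ e = false ∧ ¬ G.Conn ρ a b ∧ ¬ G.Conn ρ c b).card := by
  rw [G.deleteEdge_le_iff_crosswise_le_con, G.cubeSumCon_eq_of_isCAEdge he,
    G.card_open_not_conn_eq_of_isCAEdge he, Nat.cast_le,
    Finset.filter_congr fun ρ _ => G.crosswise_iff_of_isCAEdge he ρ]

end MultiGraph

end ABEdge

end PercRepro
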